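import Summits.NavierStokesRegularity.NavierStokesRegularity.Theorems.EfficiencyFloorRigidExitTangentConeBoundedRate
import Mathlib.Analysis.SpecialFunctions.Exponential
import Mathlib.Analysis.InnerProductSpace.Calculus
import Mathlib.Analysis.Calculus.Deriv.Shift
import Mathlib.MeasureTheory.Integral.IntervalIntegral.FundThmCalculus
import HarnessLib

/-!
# Route `EfficiencyFloor`, support `RigidExit` (stmt-25513) on the `ProductionEfficiencyDecay` ladder (stmt-22866):
# THE SIMILARITY GROUP ACTING ON A PROFILE — group law, compact stabiliser, one-parameter subgroups

Helper file (`--supports stmt-NavierStokesRegularity-22866`; line `efficiency_floor`), first half of the compact-stabiliser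
SLICE for the (RATE) residue of item (i) ORBIT SELECTION isolated in `…RigidExitTangentConeRate`. The symmetry group of the
normalised-maximiser problem acts on profiles `m : ℝ³ → ℝ³` by `(λ, C, C', a) · m = λ • C (m (λ • C' (· − a)))` (`C' C = C C' = I`,
`C` inner-product preserving, `λ > 0`); parameters live in the finite-dimensional space `Q = ℝ × Op × Op × ℝ³`. This file supplies the
finite-dimensional group theory the slice argument (`…RigidExitSlice`) consumes, all stated on components (def-free):

* `orb_comp` (§2): the composition law — acting by the product `(λ₁λ₂, C₁C₂, C'₂C'₁, a₁ + λ₁⁻¹C₁a₂)` is acting twice.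
* `scale_eq_one` (§3): a group element fixing a continuous profile that vanishes at infinity and is not identically zero has scale
  `λ = 1` (sup-norm comparison at a maximiser of `‖m‖`); `exists_norm_translation_le`: its translation is bounded by a decay radius.
* `isCompact_stabiliser` (§4): hence the stabiliser `{(1, C, C', a) : C (m (C'(· − a))) = m}` is a COMPACT subset of `Q`.
* `inner_exp_smul_of_skew`, `exists_oneParam` (§5): for a tangent vector `(σ, A, −A, b)` at the identity (`A` skew) there is a
  one-parameter subgroup `t ↦ (e^{σt}, exp(tA), exp(−tA), ∫₀ᵗ e^{−σr} exp(rA) b dr)` through the identity with that velocity.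
* `orbit_const_of_fderiv_zero` (§6): if the differential of the orbit map at the identity kills `(σ, A, A', b)`, the profile is fixed
  by the whole one-parameter subgroup with that velocity (the infinitesimal stabiliser exponentiates into the stabiliser).

HONEST FRAMING: finite-dimensional calculus only; (RATE), clause (a), `RigidExit`, `LerayFloorGap`, `ProductionEfficiencyDecay`
(stmt-22866) and Navier–Stokes regularity stay OPEN; no summit statement is proved. [folklore]
-/

-- the problem directory repeats the summit name (`NavierStokesRegularity/NavierStokesRegularity`)
set_option linter.dupNamespace false

noncomputable section

open Set Filter MeasureTheory Topology Function Bornology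
open scoped InnerProductSpace RealInnerProductSpace ENNReal NNReal
open Literature.Analysis.FluidPDE

namespace Summit.NavierStokesRegularity.NavierStokesRegularity.Theorems

namespace RigidExit

namespace Slice

open TangentCone

/-! ## §1 Isometry bookkeeping -/

/-- An inner-product preserving operator of `ℝ³` is norm preserving. [folklore] -/
theorem norm_map_of_inner {C : EuclideanSpace ℝ (Fin 3) →L[ℝ] EuclideanSpace ℝ (Fin 3)}
    (hiso : ∀ v w : EuclideanSpace ℝ (Fin 3), ⟪C v, C w⟫_ℝ = ⟪v, w⟫_ℝ) (v : EuclideanSpace ℝ (Fin 3)) : ‖C v‖ = ‖v‖ := by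
  have h : ‖C v‖ ^ 2 = ‖v‖ ^ 2 := by rw [← real_inner_self_eq_norm_sq, ← real_inner_self_eq_norm_sq, hiso]
  exact (pow_left_inj₀ (norm_nonneg _) (norm_nonneg _) two_ne_zero).1 h

/-- The two-sided inverse of an inner-product preserving operator is inner-product preserving. [folklore] -/
theorem inner_map_inv {C C' : EuclideanSpace ℝ (Fin 3) →L[ℝ] EuclideanSpace ℝ (Fin 3)} (hinv' : ∀ v, C (C' v) = v)
    (hiso : ∀ v w : EuclideanSpace ℝ (Fin 3), ⟪C v, C w⟫_ℝ = ⟪v, w⟫_ℝ) (v w : EuclideanSpace ℝ (Fin 3)) :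
    ⟪C' v, C' w⟫_ℝ = ⟪v, w⟫_ℝ := by
  rw [← hiso (C' v) (C' w), hinv', hinv']

/-- The two-sided inverse of an inner-product preserving operator is norm preserving. [folklore] -/
theorem norm_map_inv {C C' : EuclideanSpace ℝ (Fin 3) →L[ℝ] EuclideanSpace ℝ (Fin 3)} (hinv' : ∀ v, C (C' v) = v)
    (hiso : ∀ v w : EuclideanSpace ℝ (Fin 3), ⟪C v, C w⟫_ℝ = ⟪v, w⟫_ℝ) (v : EuclideanSpace ℝ (Fin 3)) : ‖C' v‖ = ‖v‖ :=
  norm_map_of_inner (inner_map_inv hinv' hiso) v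

/-- An inner-product preserving operator has operator norm at most one. [folklore] -/
theorem opNorm_le_one_of_inner {C : EuclideanSpace ℝ (Fin 3) →L[ℝ] EuclideanSpace ℝ (Fin 3)}
    (hiso : ∀ v w : EuclideanSpace ℝ (Fin 3), ⟪C v, C w⟫_ℝ = ⟪v, w⟫_ℝ) : ‖C‖ ≤ 1 :=
  ContinuousLinearMap.opNorm_le_bound _ zero_le_one fun v => by rw [norm_map_of_inner hiso, one_mul]

/-! ## §2 The composition law of orbit representations -/

/-- **Composition law.** Acting on `m` by the product `(λ₁λ₂, C₁C₂, C'₂C'₁, a₁ + λ₁⁻¹C₁a₂)` is acting by `(λ₂, C₂, C'₂, a₂)` and then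
by `(λ₁, C₁, C'₁, a₁)` (`C'₁ C₁ = I`, `λ₁ ≠ 0`). [folklore] -/
theorem orb_comp (m : EuclideanSpace ℝ (Fin 3) → EuclideanSpace ℝ (Fin 3)) {l₁ : ℝ} (hl₁ : l₁ ≠ 0) (l₂ : ℝ)
    {C₁ C'₁ : EuclideanSpace ℝ (Fin 3) →L[ℝ] EuclideanSpace ℝ (Fin 3)} (h₁ : ∀ v, C'₁ (C₁ v) = v)
    (C₂ C'₂ : EuclideanSpace ℝ (Fin 3) →L[ℝ] EuclideanSpace ℝ (Fin 3)) (a₁ a₂ x : EuclideanSpace ℝ (Fin 3)) :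
    (l₁ * l₂) • (C₁ * C₂) (m ((l₁ * l₂) • (C'₂ * C'₁) (x - (a₁ + l₁⁻¹ • C₁ a₂)))) =
      l₁ • C₁ (l₂ • C₂ (m (l₂ • C'₂ (l₁ • C'₁ (x - a₁) - a₂)))) := by
  have h3 : l₁ * l₂ * l₁⁻¹ = l₂ := by field_simp
  have hin : (l₁ * l₂) • (C'₂ * C'₁) (x - (a₁ + l₁⁻¹ • C₁ a₂)) = l₂ • C'₂ (l₁ • C'₁ (x - a₁) - a₂) := by
    have e1 : C'₁ (x - (a₁ + l₁⁻¹ • C₁ a₂)) = C'₁ x - C'₁ a₁ - l₁⁻¹ • a₂ := by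
      rw [← sub_sub, map_sub, map_sub, map_smul, h₁]
    rw [mul_apply_eq_comp, e1]
    simp only [map_sub, map_smul, smul_sub, smul_smul, h3]
    rw [mul_comm l₂ l₁]
  rw [hin, mul_apply_eq_comp, map_smul, smul_smul]

/-! ## §3 Stabiliser elements: unit scale, bounded translation -/

/-- **A symmetry fixing a non-trivial profile vanishing at infinity has unit scale** (compare sup norms at a maximiser of `‖m‖`).
[folklore] -/
theorem scale_eq_one {m : EuclideanSpace ℝ (Fin 3) → EuclideanSpace ℝ (Fin 3)} (hmc : Continuous m)
    (hm0 : Tendsto m (cocompact (EuclideanSpace ℝ (Fin 3))) (𝓝 0)) {x₀ : EuclideanSpace ℝ (Fin 3)} (hx₀ : m x₀ ≠ 0)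
    {l : ℝ} (hl : 0 < l) {C C' : EuclideanSpace ℝ (Fin 3) →L[ℝ] EuclideanSpace ℝ (Fin 3)} (hinv : ∀ v, C' (C v) = v)
    (hiso : ∀ v w : EuclideanSpace ℝ (Fin 3), ⟪C v, C w⟫_ℝ = ⟪v, w⟫_ℝ) {a : EuclideanSpace ℝ (Fin 3)}
    (hfix : ∀ x, l • C (m (l • C' (x - a))) = m x) : l = 1 := by
  have hpos : 0 < ‖m x₀‖ := norm_pos_iff.2 hx₀
  have hev : ∀ᶠ x in cocompact (EuclideanSpace ℝ (Fin 3)), ‖m x‖ ≤ ‖m x₀‖ := by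
    have h1 : ∀ᶠ x in cocompact (EuclideanSpace ℝ (Fin 3)), m x ∈ Metric.ball (0 : EuclideanSpace ℝ (Fin 3)) ‖m x₀‖ :=
      hm0 (Metric.ball_mem_nhds 0 hpos)
    exact h1.mono fun x hx => by rw [Metric.mem_ball, dist_zero_right] at hx; exact hx.le
  obtain ⟨xs, hxs⟩ := (hmc.norm).exists_forall_ge' x₀ hev
  have hM : 0 < ‖m xs‖ := lt_of_lt_of_le hpos (hxs x₀)
  have h1 : l ≤ 1 := by
    have e : l • C' ((a + l⁻¹ • C xs) - a) = xs := by
      rw [add_sub_cancel_left, map_smul, hinv, smul_smul, mul_inv_cancel₀ hl.ne', one_smul]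
    have h2 := hxs (a + l⁻¹ • C xs)
    have h3 : ‖m (a + l⁻¹ • C xs)‖ = l * ‖m xs‖ := by
      rw [← hfix (a + l⁻¹ • C xs), e, norm_smul, norm_map_of_inner hiso, Real.norm_of_nonneg hl.le]
    rw [h3] at h2
    nlinarith
  have h2 : 1 ≤ l := by
    have h3 := hxs (l • C' (xs - a))
    have h4 : ‖l • C (m (l • C' (xs - a)))‖ = l * ‖m (l • C' (xs - a))‖ := by
      rw [norm_smul, norm_map_of_inner hiso, Real.norm_of_nonneg hl.le]
    rw [hfix xs] at h4
    nlinarith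
  exact le_antisymm h1 h2

/-- **Translations of stabiliser elements are bounded** by a decay radius of the profile plus `‖x₀‖`, `m x₀ ≠ 0`. [folklore] -/
theorem exists_norm_translation_le {m : EuclideanSpace ℝ (Fin 3) → EuclideanSpace ℝ (Fin 3)}
    (hm0 : Tendsto m (cocompact (EuclideanSpace ℝ (Fin 3))) (𝓝 0)) {x₀ : EuclideanSpace ℝ (Fin 3)} (hx₀ : m x₀ ≠ 0) :
    ∃ R : ℝ, ∀ (C C' : EuclideanSpace ℝ (Fin 3) →L[ℝ] EuclideanSpace ℝ (Fin 3)) (a : EuclideanSpace ℝ (Fin 3)),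
      (∀ v, C (C' v) = v) → (∀ v w : EuclideanSpace ℝ (Fin 3), ⟪C v, C w⟫_ℝ = ⟪v, w⟫_ℝ) →
      (∀ x, C (m (C' (x - a))) = m x) → ‖a‖ ≤ R := by
  have hpos : 0 < ‖m x₀‖ := norm_pos_iff.2 hx₀
  have hev : ∀ᶠ y in cocompact (EuclideanSpace ℝ (Fin 3)), ‖m y‖ < ‖m x₀‖ := by
    have h1 : ∀ᶠ y in cocompact (EuclideanSpace ℝ (Fin 3)), m y ∈ Metric.ball (0 : EuclideanSpace ℝ (Fin 3)) ‖m x₀‖ :=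
      hm0 (Metric.ball_mem_nhds 0 hpos)
    exact h1.mono fun y hy => by rwa [Metric.mem_ball, dist_zero_right] at hy
  rw [← Metric.cobounded_eq_cocompact] at hev
  obtain ⟨r, -, hr⟩ := (Metric.hasBasis_cobounded_compl_closedBall (0 : EuclideanSpace ℝ (Fin 3))).eventually_iff.1 hev
  refine ⟨r + ‖x₀‖, fun C C' a hinv' hiso hfix => ?_⟩
  have hy : ‖m (C' (x₀ - a))‖ = ‖m x₀‖ := by rw [← hfix x₀, norm_map_of_inner hiso]
  have hin : ‖C' (x₀ - a)‖ ≤ r := by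
    by_contra hcon
    have hmem : C' (x₀ - a) ∈ (Metric.closedBall (0 : EuclideanSpace ℝ (Fin 3)) r)ᶜ := by
      rw [Set.mem_compl_iff, Metric.mem_closedBall, dist_zero_right]
      exact hcon
    have := hr hmem
    rw [hy] at this
    exact lt_irrefl _ this
  rw [norm_map_inv hinv' hiso] at hin
  calc ‖a‖ = ‖x₀ - (x₀ - a)‖ := by rw [sub_sub_cancel]
    _ ≤ ‖x₀‖ + ‖x₀ - a‖ := norm_sub_le _ _
    _ ≤ r + ‖x₀‖ := by linarith

/-! ## §4 The stabiliser is compact -/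

/-- **The stabiliser of a non-trivial continuous profile vanishing at infinity is a compact subset of the parameter space**
`ℝ × Op × Op × ℝ³` (unit scale, isometries, bounded translations; all conditions closed). [folklore] -/
theorem isCompact_stabiliser {m : EuclideanSpace ℝ (Fin 3) → EuclideanSpace ℝ (Fin 3)} (hmc : Continuous m)
    (hm0 : Tendsto m (cocompact (EuclideanSpace ℝ (Fin 3))) (𝓝 0)) {x₀ : EuclideanSpace ℝ (Fin 3)} (hx₀ : m x₀ ≠ 0) :
    IsCompact {q : ℝ × ((EuclideanSpace ℝ (Fin 3) →L[ℝ] EuclideanSpace ℝ (Fin 3)) ×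
      ((EuclideanSpace ℝ (Fin 3) →L[ℝ] EuclideanSpace ℝ (Fin 3)) × EuclideanSpace ℝ (Fin 3))) |
      q.1 = 1 ∧ (∀ v, q.2.2.1 (q.2.1 v) = v) ∧ (∀ v, q.2.1 (q.2.2.1 v) = v) ∧
      (∀ v w : EuclideanSpace ℝ (Fin 3), ⟪q.2.1 v, q.2.1 w⟫_ℝ = ⟪v, w⟫_ℝ) ∧
      ∀ x, q.1 • q.2.1 (m (q.1 • q.2.2.1 (x - q.2.2.2))) = m x} := by
  obtain ⟨R, hR⟩ := exists_norm_translation_le hm0 hx₀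
  have hc1 : Continuous fun q : ℝ × ((EuclideanSpace ℝ (Fin 3) →L[ℝ] EuclideanSpace ℝ (Fin 3)) ×
      ((EuclideanSpace ℝ (Fin 3) →L[ℝ] EuclideanSpace ℝ (Fin 3)) × EuclideanSpace ℝ (Fin 3))) => q.1 := continuous_fst
  have hc2 : Continuous fun q : ℝ × ((EuclideanSpace ℝ (Fin 3) →L[ℝ] EuclideanSpace ℝ (Fin 3)) ×
      ((EuclideanSpace ℝ (Fin 3) →L[ℝ] EuclideanSpace ℝ (Fin 3)) × EuclideanSpace ℝ (Fin 3))) => q.2.1 := continuous_snd.fst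
  have hc3 : Continuous fun q : ℝ × ((EuclideanSpace ℝ (Fin 3) →L[ℝ] EuclideanSpace ℝ (Fin 3)) ×
      ((EuclideanSpace ℝ (Fin 3) →L[ℝ] EuclideanSpace ℝ (Fin 3)) × EuclideanSpace ℝ (Fin 3))) => q.2.2.1 :=
    continuous_snd.snd.fst
  have hc4 : Continuous fun q : ℝ × ((EuclideanSpace ℝ (Fin 3) →L[ℝ] EuclideanSpace ℝ (Fin 3)) ×
      ((EuclideanSpace ℝ (Fin 3) →L[ℝ] EuclideanSpace ℝ (Fin 3)) × EuclideanSpace ℝ (Fin 3))) => q.2.2.2 :=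
    continuous_snd.snd.snd
  apply Metric.isCompact_of_isClosed_isBounded
  · have k1 : IsClosed {q : ℝ × ((EuclideanSpace ℝ (Fin 3) →L[ℝ] EuclideanSpace ℝ (Fin 3)) ×
        ((EuclideanSpace ℝ (Fin 3) →L[ℝ] EuclideanSpace ℝ (Fin 3)) × EuclideanSpace ℝ (Fin 3))) | q.1 = 1} :=
      isClosed_eq hc1 continuous_const
    have k2 : IsClosed {q : ℝ × ((EuclideanSpace ℝ (Fin 3) →L[ℝ] EuclideanSpace ℝ (Fin 3)) ×
        ((EuclideanSpace ℝ (Fin 3) →L[ℝ] EuclideanSpace ℝ (Fin 3)) × EuclideanSpace ℝ (Fin 3))) | ∀ v, q.2.2.1 (q.2.1 v) = v} := by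
      rw [Set.setOf_forall]
      exact isClosed_iInter fun v => isClosed_eq (hc3.clm_apply (hc2.clm_apply continuous_const)) continuous_const
    have k3 : IsClosed {q : ℝ × ((EuclideanSpace ℝ (Fin 3) →L[ℝ] EuclideanSpace ℝ (Fin 3)) ×
        ((EuclideanSpace ℝ (Fin 3) →L[ℝ] EuclideanSpace ℝ (Fin 3)) × EuclideanSpace ℝ (Fin 3))) | ∀ v, q.2.1 (q.2.2.1 v) = v} := by
      rw [Set.setOf_forall]
      exact isClosed_iInter fun v => isClosed_eq (hc2.clm_apply (hc3.clm_apply continuous_const)) continuous_const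
    have k4 : IsClosed {q : ℝ × ((EuclideanSpace ℝ (Fin 3) →L[ℝ] EuclideanSpace ℝ (Fin 3)) ×
        ((EuclideanSpace ℝ (Fin 3) →L[ℝ] EuclideanSpace ℝ (Fin 3)) × EuclideanSpace ℝ (Fin 3))) |
        ∀ v w : EuclideanSpace ℝ (Fin 3), ⟪q.2.1 v, q.2.1 w⟫_ℝ = ⟪v, w⟫_ℝ} := by
      rw [Set.setOf_forall]
      refine isClosed_iInter fun v => ?_
      rw [Set.setOf_forall]
      exact isClosed_iInter fun w =>
        isClosed_eq ((hc2.clm_apply continuous_const).inner (hc2.clm_apply continuous_const)) continuous_const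
    have k5 : IsClosed {q : ℝ × ((EuclideanSpace ℝ (Fin 3) →L[ℝ] EuclideanSpace ℝ (Fin 3)) ×
        ((EuclideanSpace ℝ (Fin 3) →L[ℝ] EuclideanSpace ℝ (Fin 3)) × EuclideanSpace ℝ (Fin 3))) |
        ∀ x, q.1 • q.2.1 (m (q.1 • q.2.2.1 (x - q.2.2.2))) = m x} := by
      rw [Set.setOf_forall]
      exact isClosed_iInter fun x => isClosed_eq
        (hc1.smul (hc2.clm_apply (hmc.comp (hc1.smul (hc3.clm_apply (continuous_const.sub hc4)))))) continuous_const
    simp only [Set.setOf_and]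
    exact k1.inter (k2.inter (k3.inter (k4.inter k5)))
  · rw [isBounded_iff_forall_norm_le]
    refine ⟨max 1 R, fun q hq => ?_⟩
    obtain ⟨h1, -, h3, h4, h5⟩ := hq
    have n1 : ‖q.1‖ ≤ 1 := by rw [h1, norm_one]
    have n2 : ‖q.2.1‖ ≤ 1 := opNorm_le_one_of_inner h4
    have n3 : ‖q.2.2.1‖ ≤ 1 := opNorm_le_one_of_inner (inner_map_inv h3 h4)
    have n4 : ‖q.2.2.2‖ ≤ R := hR q.2.1 q.2.2.1 q.2.2.2 h3 h4 fun x => by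
      have := h5 x
      rwa [h1, one_smul, one_smul] at this
    rw [Prod.norm_def, Prod.norm_def, Prod.norm_def]
    exact max_le (n1.trans (le_max_left _ _)) (max_le (n2.trans (le_max_left _ _))
      (max_le (n3.trans (le_max_left 1 R)) (n4.trans (le_max_right 1 R))))

/-! ## §5 One-parameter subgroups -/

/-- Products of exponentials of multiples of one operator. [folklore] -/
theorem exp_smul_mul_exp_smul (A : EuclideanSpace ℝ (Fin 3) →L[ℝ] EuclideanSpace ℝ (Fin 3)) (s t : ℝ) :
    NormedSpace.exp (s • A) * NormedSpace.exp (t • A) = NormedSpace.exp ((s + t) • A) := by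
  letI : NormedAlgebra ℚ (EuclideanSpace ℝ (Fin 3) →L[ℝ] EuclideanSpace ℝ (Fin 3)) :=
    NormedAlgebra.restrictScalars ℚ ℝ (EuclideanSpace ℝ (Fin 3) →L[ℝ] EuclideanSpace ℝ (Fin 3))
  have hc : Commute (s • A) (t • A) := by
    change (s • A) * (t • A) = (t • A) * (s • A)
    refine ContinuousLinearMap.ext fun v => ?_
    simp only [mul_apply_eq_comp, smul_apply, map_smul, smul_smul, mul_comm s t]
  rw [show (s + t) • A = s • A + t • A from add_smul s t A, NormedSpace.exp_add_of_commute hc]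

/-- **Exponentials of skew operators preserve inner products.** [folklore] -/
theorem inner_exp_smul_of_skew {A : EuclideanSpace ℝ (Fin 3) →L[ℝ] EuclideanSpace ℝ (Fin 3)}
    (hA : ∀ v w : EuclideanSpace ℝ (Fin 3), ⟪A v, w⟫_ℝ = -⟪v, A w⟫_ℝ) (t : ℝ) (v w : EuclideanSpace ℝ (Fin 3)) :
    ⟪NormedSpace.exp (t • A) v, NormedSpace.exp (t • A) w⟫_ℝ = ⟪v, w⟫_ℝ := by
  have hd : ∀ s : ℝ, HasDerivAt (fun u : ℝ => ⟪NormedSpace.exp (u • A) v, NormedSpace.exp (u • A) w⟫_ℝ) 0 s := by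
    intro s
    have h1 : HasDerivAt (fun u : ℝ => NormedSpace.exp (u • A) v) (A (NormedSpace.exp (s • A) v)) s := by
      have := (hasDerivAt_exp_smul_const' (𝕂 := ℝ) A s).clm_apply (hasDerivAt_const s v)
      simpa [mul_apply_eq_comp] using this
    have h2 : HasDerivAt (fun u : ℝ => NormedSpace.exp (u • A) w) (A (NormedSpace.exp (s • A) w)) s := by
      have := (hasDerivAt_exp_smul_const' (𝕂 := ℝ) A s).clm_apply (hasDerivAt_const s w)
      simpa [mul_apply_eq_comp] using this
    have h3 := h1.inner (𝕜 := ℝ) h2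
    have hz : ⟪NormedSpace.exp (s • A) v, A (NormedSpace.exp (s • A) w)⟫_ℝ +
        ⟪A (NormedSpace.exp (s • A) v), NormedSpace.exp (s • A) w⟫_ℝ = 0 := by
      have := hA (NormedSpace.exp (s • A) v) (NormedSpace.exp (s • A) w)
      linarith
    rwa [hz] at h3
  have hdiff : Differentiable ℝ (fun u : ℝ => ⟪NormedSpace.exp (u • A) v, NormedSpace.exp (u • A) w⟫_ℝ) :=
    fun s => (hd s).differentiableAt
  have hconst := is_const_of_deriv_eq_zero hdiff (fun s => (hd s).deriv) t 0
  rw [hconst, show ((0 : ℝ) • A) = 0 from zero_smul ℝ A, NormedSpace.exp_zero, one_apply_eq_self, one_apply_eq_self]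

/-- **One-parameter subgroups of the similarity group.** For every `σ ∈ ℝ`, skew `A` and `b ∈ ℝ³` the path
`t ↦ (e^{σt}, exp(tA), exp(−tA), ∫₀ᵗ e^{−σr} exp(rA) b dr)` starts at the identity with velocity `(σ, A, −A, b)`, stays in the group
(positive scale, mutually inverse isometries) and is a homomorphism for the product `(λ₁λ₂, C₁C₂, C'₂C'₁, a₁ + λ₁⁻¹C₁a₂)`.
[folklore] -/
theorem exists_oneParam (σ : ℝ) {A : EuclideanSpace ℝ (Fin 3) →L[ℝ] EuclideanSpace ℝ (Fin 3)}
    (hA : ∀ v w : EuclideanSpace ℝ (Fin 3), ⟪A v, w⟫_ℝ = -⟪v, A w⟫_ℝ) (b : EuclideanSpace ℝ (Fin 3)) :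
    ∃ (lamc : ℝ → ℝ) (Cc Cc' : ℝ → (EuclideanSpace ℝ (Fin 3) →L[ℝ] EuclideanSpace ℝ (Fin 3))) (ac : ℝ → EuclideanSpace ℝ (Fin 3)),
      lamc 0 = 1 ∧ Cc 0 = 1 ∧ Cc' 0 = 1 ∧ ac 0 = 0 ∧ (∀ t, 0 < lamc t) ∧
      (∀ t v, Cc' t (Cc t v) = v) ∧ (∀ t v, Cc t (Cc' t v) = v) ∧
      (∀ t (v w : EuclideanSpace ℝ (Fin 3)), ⟪Cc t v, Cc t w⟫_ℝ = ⟪v, w⟫_ℝ) ∧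
      (∀ s t, lamc (s + t) = lamc s * lamc t) ∧ (∀ s t, Cc (s + t) = Cc s * Cc t) ∧
      (∀ s t, Cc' (s + t) = Cc' t * Cc' s) ∧ (∀ s t, ac (s + t) = ac s + (lamc s)⁻¹ • Cc s (ac t)) ∧
      HasDerivAt lamc σ 0 ∧ HasDerivAt Cc A 0 ∧ HasDerivAt Cc' (-A) 0 ∧ HasDerivAt ac b 0 := by
  -- the translation integrand
  set f : ℝ → EuclideanSpace ℝ (Fin 3) := fun r => Real.exp (-(σ * r)) • NormedSpace.exp (r • A) b with hf
  have hec : Continuous fun r : ℝ => NormedSpace.exp (r • A) :=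
    continuous_iff_continuousAt.2 fun r => (hasDerivAt_exp_smul_const' (𝕂 := ℝ) A r).continuousAt
  have hfc : Continuous f :=
    (Real.continuous_exp.comp (continuous_const.mul continuous_id).neg).smul (hec.clm_apply continuous_const)
  refine ⟨fun t => Real.exp (σ * t), fun t => NormedSpace.exp (t • A), fun t => NormedSpace.exp ((-t) • A),
    fun t => ∫ r in (0 : ℝ)..t, f r, ?_, ?_, ?_, ?_, ?_, ?_, ?_, ?_, ?_, ?_, ?_, ?_, ?_, ?_, ?_, ?_⟩
  · simp
  · show NormedSpace.exp ((0 : ℝ) • A) = 1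
    rw [show ((0 : ℝ) • A) = 0 from zero_smul ℝ A, NormedSpace.exp_zero]
  · show NormedSpace.exp ((-(0 : ℝ)) • A) = 1
    rw [neg_zero, show ((0 : ℝ) • A) = 0 from zero_smul ℝ A, NormedSpace.exp_zero]
  · simp
  · exact fun t => Real.exp_pos _
  · intro t v
    show NormedSpace.exp ((-t) • A) (NormedSpace.exp (t • A) v) = v
    rw [← mul_apply_eq_comp, exp_smul_mul_exp_smul, neg_add_cancel, show ((0 : ℝ) • A) = 0 from zero_smul ℝ A,
      NormedSpace.exp_zero, one_apply_eq_self]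
  · intro t v
    show NormedSpace.exp (t • A) (NormedSpace.exp ((-t) • A) v) = v
    rw [← mul_apply_eq_comp, exp_smul_mul_exp_smul, add_neg_cancel, show ((0 : ℝ) • A) = 0 from zero_smul ℝ A,
      NormedSpace.exp_zero, one_apply_eq_self]
  · exact fun t v w => inner_exp_smul_of_skew hA t v w
  · intro s t
    show Real.exp (σ * (s + t)) = Real.exp (σ * s) * Real.exp (σ * t)
    rw [mul_add, Real.exp_add]
  · intro s t
    show NormedSpace.exp ((s + t) • A) = NormedSpace.exp (s • A) * NormedSpace.exp (t • A)
    rw [exp_smul_mul_exp_smul]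
  · intro s t
    show NormedSpace.exp ((-(s + t)) • A) = NormedSpace.exp ((-t) • A) * NormedSpace.exp ((-s) • A)
    rw [exp_smul_mul_exp_smul, show -t + -s = -(s + t) by ring]
  · intro s t
    show (∫ r in (0 : ℝ)..(s + t), f r) = (∫ r in (0 : ℝ)..s, f r) + (Real.exp (σ * s))⁻¹ • NormedSpace.exp (s • A) (∫ r in (0 : ℝ)..t, f r)
    rw [← intervalIntegral.integral_add_adjacent_intervals (hfc.intervalIntegrable 0 s) (hfc.intervalIntegrable s (s + t))]
    congr 1
    have e1 : (∫ r in (0 : ℝ)..t, f (r + s)) = ∫ r in s..s + t, f r := by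
      rw [intervalIntegral.integral_comp_add_right, zero_add, add_comm t s]
    have e2 : ∀ r, f (r + s) = (Real.exp (σ * s))⁻¹ • NormedSpace.exp (s • A) (f r) := by
      intro r
      simp only [hf]
      rw [map_smul, smul_smul, ← Real.exp_neg, ← Real.exp_add, ← mul_apply_eq_comp, exp_smul_mul_exp_smul,
        add_comm s r]
      congr 1
      congr 1
      ring
    rw [← e1]
    simp_rw [e2]
    rw [intervalIntegral.integral_smul, ContinuousLinearMap.intervalIntegral_comp_comm _ (hfc.intervalIntegrable 0 t)]
  · have := ((hasDerivAt_id (0 : ℝ)).const_mul σ).exp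
    simpa using this
  · have h : HasDerivAt (fun u : ℝ => NormedSpace.exp (u • A)) (A * NormedSpace.exp ((0 : ℝ) • A)) 0 :=
      hasDerivAt_exp_smul_const' (𝕂 := ℝ) A 0
    have e : A * NormedSpace.exp ((0 : ℝ) • A) = A := by
      rw [show ((0 : ℝ) • A) = 0 from zero_smul ℝ A, NormedSpace.exp_zero, mul_one]
    rwa [e] at h
  · have e : (fun t : ℝ => NormedSpace.exp ((-t) • A)) = fun t => NormedSpace.exp (t • (-A)) := by
      funext t
      rw [show (-t) • A = -(t • A) from neg_smul t A, show t • (-A) = -(t • A) from smul_neg t A]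
    rw [e]
    have h : HasDerivAt (fun u : ℝ => NormedSpace.exp (u • (-A))) ((-A) * NormedSpace.exp ((0 : ℝ) • (-A))) 0 :=
      hasDerivAt_exp_smul_const' (𝕂 := ℝ) (-A) 0
    have e' : (-A) * NormedSpace.exp ((0 : ℝ) • (-A)) = -A := by
      rw [show ((0 : ℝ) • (-A)) = 0 from zero_smul ℝ (-A), NormedSpace.exp_zero, mul_one]
    rwa [e'] at h
  · have hf0 : f 0 = b := by
      simp only [hf, mul_zero, neg_zero, Real.exp_zero, one_smul]
      rw [show ((0 : ℝ) • A) = 0 from zero_smul ℝ A, NormedSpace.exp_zero, one_apply_eq_self]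
    have := (hfc.integral_hasStrictDerivAt 0 0).hasDerivAt
    rwa [hf0] at this

/-! ## §6 The infinitesimal stabiliser exponentiates into the stabiliser -/

/-- **If the differential of the orbit map at the identity kills the velocity of a one-parameter subgroup, the subgroup fixes the
profile.** For differentiable `m`, a one-parameter subgroup `t ↦ (λ(t), C(t), C'(t), a(t))` (homomorphism for the product, through
the identity, `C'(t) C(t) = I`, `λ(t) > 0`) with velocity `(σ, A, A', b)` at `t = 0`, and
`D_q[q.1 • q.2.1 (m (q.1 • q.2.2.1 (x − q.2.2.2)))](1, I, I, 0) · (σ, A, A', b) = 0` for every `x`, one has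
`λ(t) • C(t) (m (λ(t) • C'(t) (x − a(t)))) = m x` for all `t`, `x` (the derivative in `t` vanishes identically by the homomorphism
property, so the orbit through `m` along the subgroup is constant). [folklore] -/
theorem orbit_const_of_fderiv_zero {m : EuclideanSpace ℝ (Fin 3) → EuclideanSpace ℝ (Fin 3)} (hmd : Differentiable ℝ m)
    {lamc : ℝ → ℝ} {Cc Cc' : ℝ → (EuclideanSpace ℝ (Fin 3) →L[ℝ] EuclideanSpace ℝ (Fin 3))} {ac : ℝ → EuclideanSpace ℝ (Fin 3)}
    (hl0 : lamc 0 = 1) (hC0 : Cc 0 = 1) (hC'0 : Cc' 0 = 1) (ha0 : ac 0 = 0) (hpos : ∀ t, 0 < lamc t)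
    (hinv : ∀ t v, Cc' t (Cc t v) = v)
    (hml : ∀ s t, lamc (s + t) = lamc s * lamc t) (hmC : ∀ s t, Cc (s + t) = Cc s * Cc t)
    (hmC' : ∀ s t, Cc' (s + t) = Cc' t * Cc' s) (hma : ∀ s t, ac (s + t) = ac s + (lamc s)⁻¹ • Cc s (ac t))
    {σ : ℝ} {A A' : EuclideanSpace ℝ (Fin 3) →L[ℝ] EuclideanSpace ℝ (Fin 3)} {b : EuclideanSpace ℝ (Fin 3)}
    (hdl : HasDerivAt lamc σ 0) (hdC : HasDerivAt Cc A 0) (hdC' : HasDerivAt Cc' A' 0) (hda : HasDerivAt ac b 0)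
    (hzero : ∀ x : EuclideanSpace ℝ (Fin 3), fderiv ℝ (fun q : ℝ × ((EuclideanSpace ℝ (Fin 3) →L[ℝ] EuclideanSpace ℝ (Fin 3)) ×
      ((EuclideanSpace ℝ (Fin 3) →L[ℝ] EuclideanSpace ℝ (Fin 3)) × EuclideanSpace ℝ (Fin 3))) =>
        q.1 • q.2.1 (m (q.1 • q.2.2.1 (x - q.2.2.2)))) (1, (1, (1, 0))) (σ, (A, (A', b))) = 0) :
    ∀ (t : ℝ) (x : EuclideanSpace ℝ (Fin 3)), lamc t • Cc t (m (lamc t • Cc' t (x - ac t))) = m x := by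
  intro t₀ x
  set ψ : ℝ → EuclideanSpace ℝ (Fin 3) := fun t => lamc t • Cc t (m (lamc t • Cc' t (x - ac t))) with hψ
  set γ : ℝ → ℝ × ((EuclideanSpace ℝ (Fin 3) →L[ℝ] EuclideanSpace ℝ (Fin 3)) ×
      ((EuclideanSpace ℝ (Fin 3) →L[ℝ] EuclideanSpace ℝ (Fin 3)) × EuclideanSpace ℝ (Fin 3))) :=
    fun s => (lamc s, (Cc s, (Cc' s, ac s))) with hγ
  have hγd : HasDerivAt γ (σ, (A, (A', b))) 0 := hdl.prodMk (hdC.prodMk (hdC'.prodMk hda))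
  have hγ0 : γ 0 = (1, (1, (1, 0))) := by simp [hγ, hl0, hC0, hC'0, ha0]
  have hd : ∀ t, HasDerivAt ψ 0 t := by
    intro t
    set y : EuclideanSpace ℝ (Fin 3) := lamc t • Cc' t (x - ac t) with hy
    -- the orbit map at `y` along `γ`
    set F : ℝ × ((EuclideanSpace ℝ (Fin 3) →L[ℝ] EuclideanSpace ℝ (Fin 3)) × ((EuclideanSpace ℝ (Fin 3) →L[ℝ]
        EuclideanSpace ℝ (Fin 3)) × EuclideanSpace ℝ (Fin 3))) → EuclideanSpace ℝ (Fin 3) :=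
      fun q => q.1 • q.2.1 (m (q.1 • q.2.2.1 (y - q.2.2.2))) with hF
    have hFd : HasFDerivAt F (fderiv ℝ F (1, (1, (1, 0)))) (γ 0) := by
      rw [hγ0]
      exact (differentiableAt_orbitParam hmd y _).hasFDerivAt
    have hcomp : HasDerivAt (F ∘ γ) (fderiv ℝ F (1, (1, (1, 0))) (σ, (A, (A', b)))) 0 := hFd.comp_hasDerivAt 0 hγd
    rw [hzero y] at hcomp
    have h2 : HasDerivAt (fun s => lamc t • Cc t ((F ∘ γ) s)) (lamc t • Cc t 0) 0 :=
      ((Cc t).hasFDerivAt.comp_hasDerivAt 0 hcomp).const_smul (lamc t)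
    rw [map_zero, smul_zero] at h2
    -- `ψ (t + s)` is that function of `s`
    have hshift : ∀ s, ψ (t + s) = lamc t • Cc t ((F ∘ γ) s) := by
      intro s
      simp only [hψ, Function.comp_apply, hF, hγ, hy, hml, hmC, hmC', hma]
      exact orb_comp m (hpos t).ne' (lamc s) (hinv t) (Cc s) (Cc' s) (ac t) (ac s) x
    have h3 : HasDerivAt (fun s => ψ (t + s)) 0 0 := h2.congr_of_eventuallyEq (Eventually.of_forall hshift)
    have h4 : HasDerivAt (fun s => ψ (t + s)) 0 (-t + t) := by rwa [neg_add_cancel]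
    have h5 := h4.comp_const_add (-t) t
    refine h5.congr_of_eventuallyEq (Eventually.of_forall fun r => ?_)
    simp only [add_neg_cancel_left]
  have hdiff : Differentiable ℝ ψ := fun t => (hd t).differentiableAt
  have hconst := is_const_of_deriv_eq_zero hdiff (fun t => (hd t).deriv) t₀ 0
  have hψ0 : ψ 0 = m x := by simp [hψ, hl0, hC0, hC'0, ha0]
  rw [← hψ0]
  exact hconst

end Slice

end RigidExit

end Summit.NavierStokesRegularity.NavierStokesRegularity.Theorems
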